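import Literature.AlgebraicTopology.SingularHomology.CochainExhaustionMilnor
import Literature.AlgebraicTopology.SingularHomology.TowerLim1FiniteDimensional
import Literature.AlgebraicTopology.SingularHomology.CupProduct
import HarnessLib

/-!
# Cup-generation of `Hᵏ⁺¹` passes from the compact pieces of an exhaustion to the whole space
# (Milnor sequence + Mittag-Leffler)

Topic `Literature/AlgebraicTopology/SingularHomology`, sibling of `CochainExhaustionMilnor.lean`
(the Milnor sequence `0 → lim¹ Hᵏ(Oₙ) → Hᵏ⁺¹(X) → lim Hᵏ⁺¹(Oₙ) → 0` of an increasing OPEN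
exhaustion `X = ⋃ Oₙ`; A. Hatcher, *Algebraic Topology* (2002), §3.F Thm. 3F.8) and of
`TowerLim1FiniteDimensional.lean` (`lim¹ = 0` and compatible preimages along towers whose
transition maps have finite rank; C. Weibel, *An Introduction to Homological Algebra* (1994),
Prop. 3.5.7). It proves the passage "from the finite sub-complexes to the whole base" of
Leray-type generation statements:

* `exists_eq_sum_cupProduct_of_exhaustion` — for `X = ⋃ₙ Oₙ` (open, increasing) interleaved
  with subspaces `Oₙ ⊆ Cₙ ⊆ Oₙ₊₁` of finite-dimensional cohomology in the relevant degrees, and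
  finitely many classes `g_j ∈ H^{d_j}(X; K)`: if on every `Cₙ` each class of `Hᵏ⁺¹(Cₙ; K)` is
  `Σ_j g_j|_{Cₙ} ⌣ v_j`, then each class of `Hᵏ⁺¹(X; K)` is `Σ_j g_j ⌣ w_j`;
* `finiteDimensional_range_map_inclusion` — restrictions `Hᵠ(B) → Hᵠ(A)` through a piece
  `A ⊆ C ⊆ B` of finite-dimensional `Hᵠ(C)` have finite rank (the Mittag-Leffler input).

Use (brick of `Literature.AlgebraicGeometry.HodgeTheory.Arapura2022_thm_1_2_smoothPart_pgZeroSurfaceFibration`,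
D. Arapura, Pacific J. Math. 319 (2022), proof of Cor. 1.5: `H⁴(V) = h ∪ H²(V) + Σ_i H²(V) ∪ [𝒵_i]`
for a surface bundle `V → U` over an AFFINE surface): `U(ℂ)` is exhausted by the compact
sublevel sets `{f ≤ aₙ}` of a proper Morse function (Andreotti–Frankel,
`AndreottiFrankelHomotopyType.lean`), each homotopy equivalent to a finite `2`-complex over which
the generation statement holds (`FiltrationLefschetzCupGeneration.lean`); with `Oₙ = π⁻¹{f < aₙ}`,
`Cₙ = π⁻¹{f ≤ aₙ}` this theorem gives it on `V(ℂ)`. Everything is proved; no definition and no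
named fact is introduced (D-0026).

## References

* A. Hatcher, *Algebraic Topology*, CUP (2002), §3.F Thm. 3F.8 and p. 313. [HatcherAT2002]
* C. Weibel, *An Introduction to Homological Algebra*, CUP (1994), §3.5 Prop. 3.5.7. [Weibel1994]
* D. Arapura, *Hodge cycles and the Leray filtration*, Pacific J. Math. 319 (2022), proof of
  Cor. 1.5 (p. 5). [Arapura2022]
-/


noncomputable section

open CategoryTheory Set Function

universe u v

namespace Literature.AlgebraicTopology.SingularHomology

variable (K : Type v) [Field K] {X : Type u} [TopologicalSpace X]

/-- Restricting from `X` to `B` and then to `A ⊆ B` is restricting to `A`. [folklore] -/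
theorem map_inclusion_map_subsetIncl {A B : Set X} (h : A ⊆ B) (q : ℕ)
    (x : singularCohomology K K X q) :
    singularCohomology.map K K (ContinuousMap.inclusion h) q
        (singularCohomology.map K K (subsetIncl B) q x) =
      singularCohomology.map K K (subsetIncl A) q x := by
  rw [← ModuleCat.comp_apply, ← singularCohomology.map_comp]
  rfl

/-- **Restrictions through a piece of finite-dimensional cohomology have finite rank**: for
`A ⊆ C ⊆ B` with `Hᵠ(C; K)` finite-dimensional, `Hᵠ(B; K) → Hᵠ(A; K)` has finite-dimensional
range. [folklore] -/
theorem finiteDimensional_range_map_inclusion {A C B : Set X} (hAC : A ⊆ C) (hCB : C ⊆ B)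
    (q : ℕ) [FiniteDimensional K (singularCohomology K K ↥C q)] :
    FiniteDimensional K
      ↥(LinearMap.range (singularCohomology.map K K (ContinuousMap.inclusion (hAC.trans hCB)) q).hom) := by
  have hfac : singularCohomology.map K K (ContinuousMap.inclusion (hAC.trans hCB)) q =
      singularCohomology.map K K (ContinuousMap.inclusion hCB) q ≫
        singularCohomology.map K K (ContinuousMap.inclusion hAC) q := by
    rw [← singularCohomology.map_comp]
    rfl
  rw [hfac, ModuleCat.hom_comp, LinearMap.range_comp]
  infer_instance

variable {O : ℕ → Set X} (hOo : ∀ n, IsOpen (O n)) (hmono : Monotone O) (hO : ⋃ n, O n = univ)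

include hOo hmono hO in
/-- **Cup-generation passes to an exhaustion.** Let `X = ⋃ₙ Oₙ` be an increasing open
exhaustion interleaved with subspaces `Oₙ ⊆ Cₙ ⊆ Oₙ₊₁` whose cohomology `H^{e_j}(Cₙ; K)`,
`Hᵏ(Cₙ; K)` is finite-dimensional (typically `Cₙ` compact: sublevel sets of a proper function),
and let `g_j ∈ H^{d_j}(X; K)` (`j` in a finite set, `d_j + e_j = k + 1`) be classes such that on
every `Cₙ` each class of `Hᵏ⁺¹(Cₙ; K)` is `Σ_j g_j|_{Cₙ} ⌣ v_j`. Then every `c ∈ Hᵏ⁺¹(X; K)` is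
`Σ_j g_j ⌣ w_j`. Proof: the solution sets `{v | Σ_j g_j|_{Oₙ} ⌣ v_j = c|_{Oₙ}}` are non-empty
affine subspaces of the tower `(Π_j H^{e_j}(Oₙ))ₙ`, whose transition maps have finite rank (they
factor through `H^{e_j}(Cₙ)`), so they admit a COMPATIBLE family of solutions
(`exists_compatible_preimages_of_finiteDimensional_range`, Mittag-Leffler); by the surjectivity
`H^{e_j}(X) ↠ lim H^{e_j}(Oₙ)` of the Milnor sequence it lifts to classes `w_j` on `X`; the
difference `c - Σ_j g_j ⌣ w_j` vanishes on every `Oₙ`, hence is a phantom class, i.e. comes from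
`lim¹ Hᵏ(Oₙ) = 0` (finite rank again). This is the passage from the finite sub-complexes to the
whole (infinite, `2`-dimensional) base in Leray-type computations such as Arapura 2022, proof of
Cor. 1.5 (`H⁴(V) = h ∪ H²(V) + Σ_i H²(V) ∪ [𝒵_i]` over an affine surface `U`, exhausted by the
compact sublevel sets of a Morse function). [cite: HatcherAT2002, §3.F Thm. 3F.8 and p. 313]
[cite: Weibel1994, §3.5 Prop. 3.5.7] [cite: Arapura2022, proof of Cor. 1.5 (p. 5)] -/
theorem exists_eq_sum_cupProduct_of_exhaustion {C : ℕ → Set X} (hOC : ∀ n, O n ⊆ C n)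
    (hCO : ∀ n, C n ⊆ O (n + 1)) {J : Type*} [Fintype J] {k : ℕ} {d e : J → ℕ}
    (hde : ∀ j, d j + e j = k + 1) (g : ∀ j, singularCohomology K K X (d j))
    (hfin : ∀ n j, FiniteDimensional K (singularCohomology K K ↥(C n) (e j)))
    (hfin' : ∀ n, FiniteDimensional K (singularCohomology K K ↥(C n) k))
    (hgen : ∀ n (y : singularCohomology K K ↥(C n) (k + 1)),
      ∃ v : ∀ j, singularCohomology K K ↥(C n) (e j),
        y = ∑ j, cupProduct (hde j)
          (singularCohomology.map K K (subsetIncl (C n)) (d j) (g j)) (v j))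
    (c : singularCohomology K K X (k + 1)) :
    ∃ w : ∀ j, singularCohomology K K X (e j), c = ∑ j, cupProduct (hde j) (g j) (w j) := by
  haveI := hfin
  haveI := hfin'
  -- the towers `Vₙ = Π_j H^{e_j}(Oₙ)`, `Wₙ = Hᵏ⁺¹(Oₙ)` and the maps `Φₙ v = Σ_j g_j|_{Oₙ} ⌣ v_j`
  let V : ℕ → Type _ := fun n => ∀ j, singularCohomology K K ↥(O n) (e j)
  let ρ : ∀ n, V (n + 1) →ₗ[K] V n := fun n => LinearMap.pi fun j =>
    (singularCohomology.map K K (ContinuousMap.inclusion (hmono (Nat.le_succ n))) (e j)).hom ∘ₗ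
      LinearMap.proj j
  let σ : ∀ n, singularCohomology K K ↥(O (n + 1)) (k + 1) →ₗ[K]
      singularCohomology K K ↥(O n) (k + 1) := fun n =>
    (singularCohomology.map K K (ContinuousMap.inclusion (hmono (Nat.le_succ n))) (k + 1)).hom
  let gO : ∀ n j, singularCohomology K K ↥(O n) (d j) := fun n j =>
    singularCohomology.map K K (subsetIncl (O n)) (d j) (g j)
  let Φ : ∀ n, V n →ₗ[K] singularCohomology K K ↥(O n) (k + 1) := fun n =>
    ∑ j, cupProduct (hde j) (gO n j) ∘ₗ LinearMap.proj j
  have hΦapply : ∀ n (x : V n), Φ n x = ∑ j, cupProduct (hde j) (gO n j) (x j) := fun n x => by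
    simp only [Φ, LinearMap.coe_sum, Finset.sum_apply, LinearMap.comp_apply]
    rfl
  have hgO : ∀ n j, singularCohomology.map K K (ContinuousMap.inclusion (hmono (Nat.le_succ n)))
      (d j) (gO (n + 1) j) = gO n j := fun n j =>
    map_inclusion_map_subsetIncl K (hmono (Nat.le_succ n)) (d j) (g j)
  have hΦ : ∀ n (x : V (n + 1)), σ n (Φ (n + 1) x) = Φ n (ρ n x) := by
    intro n x
    rw [hΦapply, hΦapply, map_sum]
    refine Finset.sum_congr rfl fun j _ => ?_
    change singularCohomology.map K K _ (k + 1) (cupProduct (hde j) (gO (n + 1) j) (x j)) =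
      cupProduct (hde j) (gO n j) (singularCohomology.map K K _ (e j) (x j))
    rw [cupProduct_map, hgO]
  -- the compatible family `c|_{Oₙ}`, each a value of `Φₙ` (generation on `Cₙ`, restricted)
  let cn : ∀ n, singularCohomology K K ↥(O n) (k + 1) := fun n =>
    singularCohomology.map K K (subsetIncl (O n)) (k + 1) c
  have hc : ∀ n, σ n (cn (n + 1)) = cn n := fun n =>
    map_inclusion_map_subsetIncl K (hmono (Nat.le_succ n)) (k + 1) c
  have hcΦ : ∀ n, cn n ∈ LinearMap.range (Φ n) := by
    intro n
    obtain ⟨v, hv⟩ := hgen n (singularCohomology.map K K (subsetIncl (C n)) (k + 1) c)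
    refine ⟨fun j => singularCohomology.map K K (ContinuousMap.inclusion (hOC n)) (e j) (v j), ?_⟩
    rw [hΦapply]
    change _ = singularCohomology.map K K (subsetIncl (O n)) (k + 1) c
    rw [← map_inclusion_map_subsetIncl K (hOC n) (k + 1) c, hv, map_sum]
    refine Finset.sum_congr rfl fun j _ => ?_
    rw [cupProduct_map, map_inclusion_map_subsetIncl]
  -- the transition maps of `V` have finite rank: they factor through `Π_j H^{e_j}(Cₙ)`
  haveI : ∀ n, FiniteDimensional K ↥(LinearMap.range (ρ n)) := by
    intro n
    let R₁ : V (n + 1) →ₗ[K] (∀ j, singularCohomology K K ↥(C n) (e j)) := LinearMap.pi fun j =>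
      (singularCohomology.map K K (ContinuousMap.inclusion (hCO n)) (e j)).hom ∘ₗ LinearMap.proj j
    let R₂ : (∀ j, singularCohomology K K ↥(C n) (e j)) →ₗ[K] V n := LinearMap.pi fun j =>
      (singularCohomology.map K K (ContinuousMap.inclusion (hOC n)) (e j)).hom ∘ₗ LinearMap.proj j
    have hfac : ρ n = R₂ ∘ₗ R₁ := by
      refine LinearMap.ext fun x => funext fun j => ?_
      change singularCohomology.map K K _ (e j) (x j) =
        singularCohomology.map K K _ (e j) (singularCohomology.map K K _ (e j) (x j))
      rw [← ModuleCat.comp_apply, ← singularCohomology.map_comp]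
      rfl
    rw [hfac, LinearMap.range_comp]
    infer_instance
  -- Mittag-Leffler: a compatible family of solutions …
  obtain ⟨v, hvρ, hvΦ⟩ :=
    exists_compatible_preimages_of_finiteDimensional_range ρ σ Φ hΦ cn hc hcΦ
  -- … lifted to `X` componentwise by the surjectivity half of the Milnor sequence
  have hw : ∀ j, ∃ w : singularCohomology K K X (e j),
      ∀ n, singularCohomology.map K K (subsetIncl (O n)) (e j) w = v n j := by
    intro j
    have hmem : (fun n => v n j) ∈ towerLim (M := exhH K K hmono (e j)) (exhρH K K hmono (e j)) :=
      (mem_towerLim_iff _ _).2 fun n => congrFun (hvρ n) j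
    obtain ⟨w, hw⟩ := restrictionsLim_surjective K K hOo hmono hO (e j) ⟨fun n => v n j, hmem⟩
    exact ⟨w, fun n => by rw [← restrictionsLim_apply_coe K K hmono (e j) w n, hw]⟩
  choose w hw using hw
  refine ⟨w, ?_⟩
  -- the difference vanishes on every `Oₙ`: a phantom class
  have hres : restrictionsLim K K hmono (k + 1) (c - ∑ j, cupProduct (hde j) (g j) (w j)) = 0 := by
    rw [restrictionsLim_eq_zero_iff]
    intro n
    rw [map_sub, map_sum, sub_eq_zero]
    change cn n = _
    rw [← hvΦ n, hΦapply]
    refine Finset.sum_congr rfl fun j _ => ?_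
    rw [cupProduct_map, hw]
  obtain ⟨q, hq⟩ := exists_phantomMap_eq K K hOo hmono hO k _ hres
  -- `lim¹ Hᵏ(Oₙ) = 0`: the transition maps factor through the finite-dimensional `Hᵏ(Cₙ)`
  haveI : ∀ n, FiniteDimensional K ↥(LinearMap.range (exhρH K K hmono k n)) := fun n =>
    finiteDimensional_range_map_inclusion K (hOC n) (hCO n) k
  haveI := subsingleton_towerLim1_of_finiteDimensional_range (exhρH K K hmono k)
  rw [Subsingleton.elim q 0, map_zero] at hq
  exact (sub_eq_zero.1 hq.symm)

end Literature.AlgebraicTopology.SingularHomology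

end
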